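import Literature.NumberTheory.GaloisRepresentations.LubinTateColemanTraceTwo
import Literature.NumberTheory.GaloisRepresentations.LubinTateColemanTraceZeroImage
import HarnessLib

/-!
# `q = 2`: `ker 𝒮 = (1 + (2/π)X)·𝒪⟦f⟧`, `im 𝒮 = π·𝒪⟦X⟧`, and de Shalit's Theorem I.3.7 for `ℚ₂` in
# power-series form — the coordinates `r_β` of the norm-coherent units

De Shalit, *Iwasawa theory of elliptic curves with complex multiplication* (1987), Ch. I §3.3 (7), Thm. 3.7,
§3.13–3.14: `0 → 𝒰 →ⁱ Λ → (𝒪/p^N)(1) → 0`, `i(β) = μ_β` the measure on `ℤ_p^×` of the Coleman power series.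
On the power-series side the measures on the units are the TRACE-ZERO series (de Shalit's (7)), reached from
`𝒰` by Coleman's `δ : 𝒰 ≅ 𝓔_π` (`LubinTateColemanLogDerivSurjTwo`) and `h ↦ h̃ = h − u·(h ∘ f) : 𝓔_π → ker 𝒮`
(`LubinTateColemanTraceZero(Image)`).  For `f = πX + X²` over `F` with `|𝓀_F| = 2` the rank-two decomposition
`g = r₀ ∘ f + X·(r₁ ∘ f)` of `LubinTateColemanTraceTwo.lean` makes everything explicit:

* ★★★ `colemanTrace_eq_zero_iff_two` (+ `eq_of_one_add_mul_subst_eq_two`,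
  `eq_one_add_mul_evenPartTwo_of_colemanTrace_eq_zero`, `oddPartTwo_eq_of_colemanTrace_eq_zero`) — with
  `2 = πt`: **`𝒮g = 0 ⟺ g = (1 + tX)·(r ∘ f)`**, `r = evenPartTwo g` unique: the trace-zero series form a FREE
  MODULE OF RANK ONE over `𝒪[F]⟦Y⟧` (`Y ↦ f`) on `1 + tX` (for `F = ℚ₂`, `π = 2`: `(1 + X)·ℤ₂⟦(1+X)² − 1⟧`,
  the series of the measures on `ℤ₂^× = 1 + 2ℤ₂`);
* ★★ `exists_colemanTrace_eq_C_mul_two`, `colemanTrace_neg_X_mul_subst_two` — **`im 𝒮 = π·𝒪[F]⟦X⟧`**;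
* `unitCoordTwo hπ hq u β = r_β` (`π = 2u`, `u` a unit, i.e. `F = ℚ₂`): the COORDINATE of a norm-coherent unit,
  ★★ `tildeSer_logDeriv_eq_unitCoordTwo` — **`(δβ)~ = (1 + u⁻¹X)·(r_β ∘ f)`**; `unitCoordTwo_mul/one`
  (a homomorphism); `constantCoeff_unitCoordTwo(_mem)` — **`r_β(0) = (1 − u)(δβ)(0) ∈ (1 − u)`**;
  ★★★ `exists_unitCoordTwo_eq` — **every `r` with `r(0) ∈ (1 − u)` is an `r_β`** (under `π ≡ m₁ mod π²`,
  automatic over `ℚ₂`); ★★★ `unitCoordTwo_injective` / `existsUnique_unitCoordTwo_eq` — **injective for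
  `u ≠ 1`** (char. `0`): THEOREM I.3.7 as the exact sequence `0 → 𝒰 → 𝒪⟦Y⟧ → 𝒪/(1 − u) → 0`
  (`𝒪/(1 − u) = (𝒪/2^N)(1)`, `N` the anomaly index); for `u = 1` (`f = 𝔾̂_m`) the kernel is the norm-coherent
  roots of unity (`unitCoordTwo_eq_iff` + `tildeSer_eq_zero_iff`);
* `PadicTwo.exists_unitCoordTwo_eq`, `PadicTwo.existsUnique_unitCoordTwo_eq`, `PadicTwo.unitCoordTwo_injective` —
  the same over `ℚ₂` for EVERY uniformizer `π = 2u`, unconditionally; `PadicTwo.colemanTrace_eq_zero_iff_cyclotomic` —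
  `𝔾̂_m` (`π = 2`): `𝒮g = 0 ⟺ g = (1 + X)·r((1 + X)² − 1)`, the series of the measures on `ℤ₂^× = 1 + 2ℤ₂`.

0 sorry, no named facts.  (The `𝒪[F]ˣ`/Galois-equivariance of `β ↦ r_β` — de Shalit's Lemma 3.4 (ii) in
coordinates — is the sequel.)

## References

* E. de Shalit, *Iwasawa theory of elliptic curves with complex multiplication* (1987), Ch. I §3.3 (7),
  §3.7 Theorem, §3.13 Lemma, §3.14. [deShalit1987]
* R. Coleman, *Division values in local fields*, Invent. Math. 53 (1979), Thm. 4. [Coleman1979]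
-/

noncomputable section

open scoped PowerSeries.WithPiTopology

namespace Literature.NumberTheory.GaloisRepresentations
section LocalFieldK2

open GaloisRepresentations.IsNonarchimedeanLocalField LubinTate ValuativeRel

variable (F : Type*) [Field F] [ValuativeRel F] [TopologicalSpace F] [IsNonarchimedeanLocalField F]

attribute [local instance] ltNormUniformSpace ltNormIsUniformAddGroup rk1 nF nE fintypeResidueField

variable {F}
variable {π : 𝒪[F]} (hπ : (valuation F).IsUniformizer (π : F)) (n : ℕ)

/-- `f` is substitutable (`f(0) = 0`). [folklore] -/
private theorem hasSubst_ltSer₃ : PowerSeries.HasSubst (ltSer F π) :=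
  PowerSeries.HasSubst.of_constantCoeff_zero' (isLTSeries_ltSer π).constantCoeff_eq_zero

include hπ in
/-- `π ≠ 0` in the coefficient ring. [folklore] -/
private theorem of_pi_ne_zero₃ : LTCoeff.of F π ≠ 0 := fun h0 => hπ.ne_zero (by
  have := congrArg (fun x => (((LTCoeff.of F).symm x : 𝒪[F]) : F)) h0
  simpa using this)

/-- `(1 + tX) · (r ∘ f) = r ∘ f + X · ((t r) ∘ f)`: the generator `1 + tX` in the coordinates of the rank-two
decomposition. [cite: deShalit1987, Ch. I §3.12] -/
theorem one_add_mul_subst_eq (t : LTCoeff F) (r : PowerSeries (LTCoeff F)) :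
    (1 + PowerSeries.C t * PowerSeries.X) * PowerSeries.subst (ltSer F π) r =
      PowerSeries.subst (ltSer F π) r + PowerSeries.X * PowerSeries.subst (ltSer F π) (PowerSeries.C t * r) := by
  rw [subst_C_mul (isLTSeries_ltSer π)]
  ring

/-! ### The kernel and the image of `𝒮` at `q = 2` -/

/-- ★★★ **`ker 𝒮 = (1 + (2/π)X) · 𝒪[F]⟦f⟧` at `q = 2`**: with `2 = π t`, `𝒮g = 0` iff `g = (1 + tX) · (r ∘ f)` for some
`r ∈ 𝒪[F]⟦X⟧` — the trace-zero series form a FREE MODULE OF RANK ONE over `𝒪[F]⟦Y⟧` (through `Y ↦ f`) on the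
generator `1 + tX` (`= 1 + X` for `F = ℚ₂`, `π = 2`: the series of the measures supported on `ℤ₂^× = 1 + 2ℤ₂`).
[cite: deShalit1987, Ch. I §3.3 (7), §3.12] -/
theorem colemanTrace_eq_zero_iff_two (hq : residueFieldCard F = 2) {t : LTCoeff F}
    (ht : (2 : LTCoeff F) = LTCoeff.of F π * t) (g : PowerSeries (LTCoeff F)) :
    colemanTrace hπ n g = 0 ↔
      ∃ r : PowerSeries (LTCoeff F), g = (1 + PowerSeries.C t * PowerSeries.X) * PowerSeries.subst (ltSer F π) r := by
  haveI : IsDomain (LTCoeff F) := inferInstanceAs (IsDomain 𝒪[F])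
  have key : ∀ r : PowerSeries (LTCoeff F), (1 + PowerSeries.C t * PowerSeries.X) * PowerSeries.subst (ltSer F π) r =
      PowerSeries.subst (ltSer F π) r + PowerSeries.X * PowerSeries.subst (ltSer F π) (PowerSeries.C t * r) := by
    intro r
    rw [subst_C_mul (isLTSeries_ltSer π)]
    ring
  constructor
  · intro h0
    obtain ⟨r₀, r₁, hg⟩ := exists_eq_subst_add_X_mul_subst_two hπ hq g
    rw [hg, colemanTrace_subst_add_X_mul_subst_two hπ n hq, ht, map_mul, mul_assoc,
      ← mul_sub, mul_eq_zero] at h0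
    rcases h0 with h0 | h0
    · exact absurd (by simpa using congrArg PowerSeries.constantCoeff h0) (of_pi_ne_zero₃ hπ)
    · refine ⟨r₀, ?_⟩
      rw [key, sub_eq_zero.mp h0]
      exact hg
  · rintro ⟨r, rfl⟩
    rw [key, colemanTrace_subst_add_X_mul_subst_two hπ n hq, ht, map_mul]
    ring

include hπ in
/-- … with `r` unique. [cite: deShalit1987, Ch. I §3.3 (7), §3.12] -/
theorem eq_of_one_add_mul_subst_eq_two (hq : residueFieldCard F = 2) (t : LTCoeff F) {r r' : PowerSeries (LTCoeff F)}
    (h : (1 + PowerSeries.C t * PowerSeries.X) * PowerSeries.subst (ltSer F π) r =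
      (1 + PowerSeries.C t * PowerSeries.X) * PowerSeries.subst (ltSer F π) r') : r = r' := by
  have key : ∀ r : PowerSeries (LTCoeff F), (1 + PowerSeries.C t * PowerSeries.X) * PowerSeries.subst (ltSer F π) r =
      PowerSeries.subst (ltSer F π) r + PowerSeries.X * PowerSeries.subst (ltSer F π) (PowerSeries.C t * r) := by
    intro r
    rw [subst_C_mul (isLTSeries_ltSer π)]
    ring
  rw [key, key] at h
  exact (subst_add_X_mul_subst_injective_two hπ hq h).1

/-- ★★ **`im 𝒮 = π · 𝒪[F]⟦X⟧` at `q = 2`, first half**: every `𝒮g` is divisible by `π` (`𝒮g = 2r₀ − πr₁ = π(t r₀ − r₁)`).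
[cite: deShalit1987, Ch. I §3.12] -/
theorem exists_colemanTrace_eq_C_mul_two (hq : residueFieldCard F = 2) (g : PowerSeries (LTCoeff F)) :
    ∃ g' : PowerSeries (LTCoeff F), colemanTrace hπ n g = PowerSeries.C (LTCoeff.of F π) * g' := by
  obtain ⟨t, ht⟩ := exists_two_eq_pi_mul hπ hq
  obtain ⟨r₀, r₁, hg⟩ := exists_eq_subst_add_X_mul_subst_two hπ hq g
  refine ⟨PowerSeries.C t * r₀ - r₁, ?_⟩
  rw [hg, colemanTrace_subst_add_X_mul_subst_two hπ n hq, ht, map_mul]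
  ring

/-- ★★ **`im 𝒮 = π · 𝒪[F]⟦X⟧` at `q = 2`, second half**: `π g' = 𝒮(−X · (g' ∘ f))`.
[cite: deShalit1987, Ch. I §3.12] -/
theorem colemanTrace_neg_X_mul_subst_two (hq : residueFieldCard F = 2) (g' : PowerSeries (LTCoeff F)) :
    colemanTrace hπ n (-PowerSeries.X * PowerSeries.subst (ltSer F π) g') = PowerSeries.C (LTCoeff.of F π) * g' := by
  rw [neg_mul, ← neg_one_mul, ← map_one PowerSeries.C, ← map_neg, colemanTrace_C_mul,
    colemanTrace_X_mul_subst_two hπ n hq, map_neg, map_one]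
  ring

/-- `2 = π · u⁻¹` when `π = 2u` (`|𝓀_F| = 2`, `u` a unit: `F` is unramified over `ℚ₂`, i.e. `F = ℚ₂`).
[cite: deShalit1987, Ch. I §3.13] -/
theorem two_eq_of_mul_inv (hq : residueFieldCard F = 2) (u : (LTCoeff F)ˣ)
    (hu : LTCoeff.of F π = residueFieldCard F * u) : (2 : LTCoeff F) = LTCoeff.of F π * ↑u⁻¹ := by
  rw [hu, hq, Nat.cast_ofNat, Units.mul_inv_cancel_right]

/-- ★ **On `ker 𝒮` the odd part is `t ·` the even part** (`2 = πt`): `𝒮g = 0 ⟹ oddPartTwo g = t · evenPartTwo g`.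
[cite: deShalit1987, Ch. I §3.3 (7), §3.12] -/
theorem oddPartTwo_eq_of_colemanTrace_eq_zero (hq : residueFieldCard F = 2) {t : LTCoeff F}
    (ht : (2 : LTCoeff F) = LTCoeff.of F π * t) {g : PowerSeries (LTCoeff F)} (hg : colemanTrace hπ n g = 0) :
    oddPartTwo hπ hq g = PowerSeries.C t * evenPartTwo hπ hq g := by
  haveI : IsDomain (LTCoeff F) := inferInstanceAs (IsDomain 𝒪[F])
  rw [colemanTrace_eq_evenPartTwo_oddPartTwo hπ n hq, ht, map_mul, mul_assoc, ← mul_sub, mul_eq_zero] at hg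
  rcases hg with h0 | h0
  · exact absurd (by simpa using congrArg PowerSeries.constantCoeff h0) (of_pi_ne_zero₃ hπ)
  · exact (sub_eq_zero.mp h0).symm

/-- ★★ **`𝒮g = 0 ⟹ g = (1 + tX) · ((evenPartTwo g) ∘ f)`**: the coordinate of a trace-zero series on the
generator `1 + tX` is its even part. [cite: deShalit1987, Ch. I §3.3 (7), §3.12] -/
theorem eq_one_add_mul_evenPartTwo_of_colemanTrace_eq_zero (hq : residueFieldCard F = 2) {t : LTCoeff F}
    (ht : (2 : LTCoeff F) = LTCoeff.of F π * t) {g : PowerSeries (LTCoeff F)} (hg : colemanTrace hπ n g = 0) :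
    g = (1 + PowerSeries.C t * PowerSeries.X) * PowerSeries.subst (ltSer F π) (evenPartTwo hπ hq g) := by
  rw [one_add_mul_subst_eq, ← oddPartTwo_eq_of_colemanTrace_eq_zero hπ n hq ht hg]
  exact eq_evenPartTwo_add_X_mul_oddPartTwo hπ hq g

/-! ### Theorem I.3.7 in power-series form: the coordinates of the norm-coherent units

For `π = 2u` with `u` a unit (`F = ℚ₂`, any uniformizer), compose Coleman's `δ : 𝒰 ≅ 𝓔_π`
(`LubinTateColemanLogDerivSurjTwo`), de Shalit's `h ↦ h̃ = h − u·(h ∘ f) : 𝓔_π → ker 𝒮`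
(`LubinTateColemanTraceZero(Image)`) and `ker 𝒮 = (1 + u⁻¹X)·𝒪⟦f⟧`: every norm-coherent unit `β` has a
COORDINATE `r_β ∈ 𝒪[F]⟦Y⟧` with `(δβ)~ = (1 + u⁻¹X)·(r_β ∘ f)`; `β ↦ r_β` is a homomorphism, its image is
`{r : r(0) ∈ (1 − u)}` (cokernel `𝒪/(1 − u) = (𝒪/2^N)(1)`, `N` the anomaly index: `ζ_{2^N} ∈ K_π^∞`), and it is
injective for `u ≠ 1` (for `u = 1`, `f = 𝔾̂_m`, the kernel is the norm-coherent `2`-power roots of unity). -/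

/-- **The coordinate `r_β` of a norm-coherent unit `β`** (`q = 2`, `π = 2u`): the even part of `(δβ)~`, so that
`(δβ)~ = (1 + u⁻¹X)·(r_β ∘ f)` (`tildeSer_logDeriv_eq_unitCoordTwo`). [cite: deShalit1987, Ch. I §3.7] -/
def unitCoordTwo (hq : residueFieldCard F = 2) (u : (LTCoeff F)ˣ) (β : NormCoherentUnits hπ) :
    PowerSeries (LTCoeff F) :=
  evenPartTwo hπ hq (tildeSer π (u : LTCoeff F) β.logDeriv)

/-- `𝒮((δβ)~) = 0` (`𝒮(δβ) = π·δβ` and `π = q u`). [cite: deShalit1987, Ch. I §3.14] -/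
theorem colemanTrace_tildeSer_logDeriv {u : LTCoeff F} (hu : LTCoeff.of F π = residueFieldCard F * u)
    (β : NormCoherentUnits hπ) : colemanTrace hπ n (tildeSer π u β.logDeriv) = 0 :=
  colemanTrace_tildeSer_eq_zero hπ n hu (β.colemanTrace_logDeriv n)

/-- ★★ **`(δβ)~ = (1 + u⁻¹X) · (r_β ∘ f)`.** [cite: deShalit1987, Ch. I §3.7] -/
theorem tildeSer_logDeriv_eq_unitCoordTwo (hq : residueFieldCard F = 2) (u : (LTCoeff F)ˣ)
    (hu : LTCoeff.of F π = residueFieldCard F * u) (β : NormCoherentUnits hπ) :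
    tildeSer π (u : LTCoeff F) β.logDeriv =
      (1 + PowerSeries.C (↑u⁻¹ : LTCoeff F) * PowerSeries.X) * PowerSeries.subst (ltSer F π) (unitCoordTwo hπ hq u β) :=
  eq_one_add_mul_evenPartTwo_of_colemanTrace_eq_zero hπ 0 hq (two_eq_of_mul_inv hq u hu)
    (colemanTrace_tildeSer_logDeriv hπ 0 hu β)

/-- **`r_{ββ'} = r_β + r_{β'}`** (`δ(ββ') = δβ + δβ'`). [cite: deShalit1987, Ch. I §3.4 Lemma (i)] -/
theorem unitCoordTwo_mul (hq : residueFieldCard F = 2) (u : (LTCoeff F)ˣ) (β β' : NormCoherentUnits hπ) :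
    unitCoordTwo hπ hq u (β.mul β') = unitCoordTwo hπ hq u β + unitCoordTwo hπ hq u β' := by
  rw [unitCoordTwo, NormCoherentUnits.logDeriv_mul, tildeSer_add, (evenPartTwo_oddPartTwo_add hπ hq _ _).1]
  rfl

/-- `r_1 = 0`. [cite: deShalit1987, Ch. I §3.4 Lemma (i)] -/
theorem unitCoordTwo_one (hq : residueFieldCard F = 2) (u : (LTCoeff F)ˣ) :
    unitCoordTwo hπ hq u NormCoherentUnits.one = 0 := by
  have h0 : tildeSer π (u : LTCoeff F) (0 : PowerSeries (LTCoeff F)) =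
      PowerSeries.subst (ltSer F π) (0 : PowerSeries (LTCoeff F)) := by
    rw [tildeSer_def, ← PowerSeries.coe_substAlgHom hasSubst_ltSer₃, map_zero, mul_zero, sub_zero]
  rw [unitCoordTwo, NormCoherentUnits.logDeriv_one, h0, (evenPartTwo_oddPartTwo_subst hπ hq 0).1]

/-- **`r_β(0) = (1 − u)·(δβ)(0)`** — the coordinates have constant term in `(1 − u)`.
[cite: deShalit1987, Ch. I §3.7] -/
theorem constantCoeff_unitCoordTwo (hq : residueFieldCard F = 2) (u : (LTCoeff F)ˣ) (β : NormCoherentUnits hπ) :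
    PowerSeries.constantCoeff (unitCoordTwo hπ hq u β) = (1 - (u : LTCoeff F)) * PowerSeries.constantCoeff β.logDeriv := by
  rw [unitCoordTwo, constantCoeff_evenPartTwo, constantCoeff_tildeSer]

/-- `r_β(0) ∈ (1 − u)`. [cite: deShalit1987, Ch. I §3.7] -/
theorem constantCoeff_unitCoordTwo_mem (hq : residueFieldCard F = 2) (u : (LTCoeff F)ˣ) (β : NormCoherentUnits hπ) :
    PowerSeries.constantCoeff (unitCoordTwo hπ hq u β) ∈ Ideal.span {1 - (u : LTCoeff F)} := by
  rw [constantCoeff_unitCoordTwo]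
  exact Ideal.mem_span_singleton.mpr (dvd_mul_right _ _)

/-- ★★★ **The image of `β ↦ r_β` is `{r : r(0) ∈ (1 − u)}`** (under `π ≡ m₁ mod π²` for some `m₁ ∈ ℕ`, automatic
for `F = ℚ₂`): given such `r`, `g = (1 + u⁻¹X)(r ∘ f)` has `𝒮g = 0` and `g(0) = r(0) ∈ (1 − u)`, so `g = h̃`
with `h ∈ 𝓔_π` (`exists_tildeSer_eq_iff`) and `h = δβ` (`δ : 𝒰 ↠ 𝓔_π` at `q = 2`).
[cite: deShalit1987, Ch. I §3.7, §3.13–3.14] -/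
theorem exists_unitCoordTwo_eq (hq : residueFieldCard F = 2) (u : (LTCoeff F)ˣ)
    (hu : LTCoeff.of F π = residueFieldCard F * u) (hm : ∃ m₁ : ℕ, LTCoeff.of F π ^ 2 ∣ LTCoeff.of F π - m₁)
    (r : PowerSeries (LTCoeff F)) (hr : PowerSeries.constantCoeff r ∈ Ideal.span {1 - (u : LTCoeff F)}) :
    ∃ β : NormCoherentUnits hπ, unitCoordTwo hπ hq u β = r := by
  set g := (1 + PowerSeries.C (↑u⁻¹ : LTCoeff F) * PowerSeries.X) * PowerSeries.subst (ltSer F π) r with hg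
  have hSg : colemanTrace hπ 0 g = 0 :=
    (colemanTrace_eq_zero_iff_two hπ 0 hq (two_eq_of_mul_inv hq u hu) g).mpr ⟨r, hg⟩
  have hg0 : PowerSeries.constantCoeff g ∈ Ideal.span {1 - (u : LTCoeff F)} := by
    rw [hg, one_add_mul_subst_eq, ← constantCoeff_evenPartTwo hπ hq, (evenPartTwo_oddPartTwo_eq hπ hq _ _).1]
    exact hr
  obtain ⟨h, hh, hhE⟩ := (exists_tildeSer_eq_iff hπ 0 hu hSg).mpr hg0
  obtain ⟨β, hβ⟩ := NormCoherentUnits.exists_logDeriv_eq hπ 0 hq hm h hhE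
  refine ⟨β, ?_⟩
  rw [unitCoordTwo, hβ, hh, hg, one_add_mul_subst_eq]
  exact (evenPartTwo_oddPartTwo_eq hπ hq _ _).1

/-- `r_β = r_{β'}` iff `(δβ)~ = (δβ')~`. [cite: deShalit1987, Ch. I §3.7] -/
theorem unitCoordTwo_eq_iff (hq : residueFieldCard F = 2) (u : (LTCoeff F)ˣ)
    (hu : LTCoeff.of F π = residueFieldCard F * u) (β β' : NormCoherentUnits hπ) :
    unitCoordTwo hπ hq u β = unitCoordTwo hπ hq u β' ↔
      tildeSer π (u : LTCoeff F) β.logDeriv = tildeSer π (u : LTCoeff F) β'.logDeriv := by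
  refine ⟨fun h => ?_, fun h => by rw [unitCoordTwo, unitCoordTwo, h]⟩
  rw [tildeSer_logDeriv_eq_unitCoordTwo hπ hq u hu, tildeSer_logDeriv_eq_unitCoordTwo hπ hq u hu, h]

/-- ★★★ **`β ↦ r_β` is injective for `u ≠ 1`** (characteristic `0`): `h ↦ h̃` is injective for `u ≠ 1`
(`tildeSer_injective`) and `δ` is injective on `𝒰` at `q = 2` (`NormCoherentUnits.logDeriv_injective`).
[cite: deShalit1987, Ch. I §3.7, §3.14] -/
theorem unitCoordTwo_injective [CharZero F] (hq : residueFieldCard F = 2) (u : (LTCoeff F)ˣ)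
    (hu : LTCoeff.of F π = residueFieldCard F * u) (hu1 : (u : LTCoeff F) ≠ 1) :
    Function.Injective (unitCoordTwo hπ hq u) := fun β β' h =>
  NormCoherentUnits.logDeriv_injective hπ hq (tildeSer_injective hπ hu1 ((unitCoordTwo_eq_iff hπ hq u hu β β').mp h))

/-- ★★★ **Theorem I.3.7 at `q = 2`, `π = 2u`, `u ≠ 1`**: `β ↦ r_β` is a bijection from the norm-coherent units
onto `{r ∈ 𝒪[F]⟦Y⟧ : r(0) ∈ (1 − u)}` — an exact sequence `0 → 𝒰 → 𝒪[F]⟦Y⟧ → 𝒪[F]/(1 − u) → 0` with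
`𝒰 ∋ β ↦ r_β`, `r ↦ r(0)`. [cite: deShalit1987, Ch. I §3.7 Theorem] -/
theorem existsUnique_unitCoordTwo_eq [CharZero F] (hq : residueFieldCard F = 2) (u : (LTCoeff F)ˣ)
    (hu : LTCoeff.of F π = residueFieldCard F * u) (hu1 : (u : LTCoeff F) ≠ 1)
    (hm : ∃ m₁ : ℕ, LTCoeff.of F π ^ 2 ∣ LTCoeff.of F π - m₁)
    (r : PowerSeries (LTCoeff F)) (hr : PowerSeries.constantCoeff r ∈ Ideal.span {1 - (u : LTCoeff F)}) :
    ∃! β : NormCoherentUnits hπ, unitCoordTwo hπ hq u β = r := by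
  obtain ⟨β, hβ⟩ := exists_unitCoordTwo_eq hπ hq u hu hm r hr
  exact ⟨β, hβ, fun β' hβ' => unitCoordTwo_injective hπ hq u hu hu1 (hβ'.trans hβ.symm)⟩

end LocalFieldK2

/-! ### `F = ℚ₂`, any uniformizer `π = 2u` -/

section PadicK2

open GaloisRepresentations.IsNonarchimedeanLocalField LubinTate ValuativeRel

attribute [local instance] ltNormUniformSpace ltNormIsUniformAddGroup rk1 nF nE fintypeResidueField

/-- ★★★ **Theorem I.3.7 over `ℚ₂` (surjectivity half), every uniformizer `π = 2u`**: every `r ∈ ℤ₂⟦Y⟧` with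
`r(0) ∈ (1 − u)` is the coordinate `r_β` of a norm-coherent unit sequence `β` of the tower of `f = πX + X²`
(`(δβ)~ = (1 + u⁻¹X)·(r ∘ f)`). [cite: deShalit1987, Ch. I §3.7 Theorem] -/
theorem PadicTwo.exists_unitCoordTwo_eq :
    haveI := Padic.isNonarchimedeanLocalField_holds 2
    ∀ {π : 𝒪[ℚ_[2]]} (hπ : (valuation ℚ_[2]).IsUniformizer (π : ℚ_[2])) (u : (LTCoeff ℚ_[2])ˣ)
      (_hu : LTCoeff.of ℚ_[2] π = residueFieldCard ℚ_[2] * u) (r : PowerSeries (LTCoeff ℚ_[2])),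
      PowerSeries.constantCoeff r ∈ Ideal.span {1 - (u : LTCoeff ℚ_[2])} →
        ∃ β : NormCoherentUnits hπ, unitCoordTwo hπ (Padic.residueFieldCard_eq 2) u β = r := by
  haveI := Padic.isNonarchimedeanLocalField_holds 2
  intro π hπ u hu r hr
  exact Literature.NumberTheory.GaloisRepresentations.exists_unitCoordTwo_eq hπ (Padic.residueFieldCard_eq 2) u hu (PadicTwo.exists_sq_dvd_sub_of_isUniformizer hπ)
    r hr

/-- ★★★ **Theorem I.3.7 over `ℚ₂` for `π ≠ 2` (`u ≠ 1`)**: `β ↦ r_β` is a BIJECTION from the norm-coherent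
units of the tower of `f = πX + X²` onto `{r ∈ ℤ₂⟦Y⟧ : r(0) ∈ (1 − u)}`; the cokernel `ℤ₂⟦Y⟧/im = ℤ₂/(1 − u)`
is the anomaly term `(ℤ₂/2^N)(1)` of de Shalit's exact sequence `0 → 𝒰 → Λ → (𝒪/p^N)(1) → 0`.
[cite: deShalit1987, Ch. I §3.7 Theorem] -/
theorem PadicTwo.existsUnique_unitCoordTwo_eq :
    haveI := Padic.isNonarchimedeanLocalField_holds 2
    ∀ {π : 𝒪[ℚ_[2]]} (hπ : (valuation ℚ_[2]).IsUniformizer (π : ℚ_[2])) (u : (LTCoeff ℚ_[2])ˣ)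
      (_hu : LTCoeff.of ℚ_[2] π = residueFieldCard ℚ_[2] * u) (_hu1 : (u : LTCoeff ℚ_[2]) ≠ 1)
      (r : PowerSeries (LTCoeff ℚ_[2])), PowerSeries.constantCoeff r ∈ Ideal.span {1 - (u : LTCoeff ℚ_[2])} →
        ∃! β : NormCoherentUnits hπ, unitCoordTwo hπ (Padic.residueFieldCard_eq 2) u β = r := by
  haveI := Padic.isNonarchimedeanLocalField_holds 2
  intro π hπ u hu hu1 r hr
  exact Literature.NumberTheory.GaloisRepresentations.existsUnique_unitCoordTwo_eq hπ (Padic.residueFieldCard_eq 2) u hu hu1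
    (PadicTwo.exists_sq_dvd_sub_of_isUniformizer hπ) r hr

/-- ★★ **… and `β ↦ r_β` is injective** over `ℚ₂` for `u ≠ 1`. [cite: deShalit1987, Ch. I §3.7 Theorem] -/
theorem PadicTwo.unitCoordTwo_injective :
    haveI := Padic.isNonarchimedeanLocalField_holds 2
    ∀ {π : 𝒪[ℚ_[2]]} (hπ : (valuation ℚ_[2]).IsUniformizer (π : ℚ_[2])) (u : (LTCoeff ℚ_[2])ˣ)
      (_hu : LTCoeff.of ℚ_[2] π = residueFieldCard ℚ_[2] * u) (_hu1 : (u : LTCoeff ℚ_[2]) ≠ 1),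
      Function.Injective (unitCoordTwo hπ (Padic.residueFieldCard_eq 2) u) := by
  haveI := Padic.isNonarchimedeanLocalField_holds 2
  intro π hπ u hu hu1
  exact Literature.NumberTheory.GaloisRepresentations.unitCoordTwo_injective hπ (Padic.residueFieldCard_eq 2) u hu hu1

/-- ★ **`𝔾̂_m` over `ℚ₂`** (`π = 2`, `[2](X) = 2X + X² = (1 + X)² − 1`, `t = 1`): **`𝒮g = 0 ⟺ g = (1 + X)·r((1 + X)² − 1)`**
for some `r ∈ ℤ₂⟦Y⟧` — the power series `∫ (1+X)^x dμ` of the measures `μ` on `ℤ₂^× = 1 + 2ℤ₂` (`μ = (1 + 2·)_* ν`,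
`r = ∫ (1+Y)^y dν`): de Shalit's support criterion (7) at `p = 2` on the series side. [cite: deShalit1987, Ch. I §3.3 (7)] -/
theorem PadicTwo.colemanTrace_eq_zero_iff_cyclotomic :
    haveI := Padic.isNonarchimedeanLocalField_holds 2
    ∀ (n : ℕ) (g : PowerSeries (LTCoeff ℚ_[2])),
      colemanTrace (Padic.isUniformizer_natCast 2) n g = 0 ↔
        ∃ r : PowerSeries (LTCoeff ℚ_[2]),
          g = (1 + PowerSeries.X) * PowerSeries.subst (ltSer ℚ_[2] ((2 : ℕ) : 𝒪[ℚ_[2]])) r := by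
  haveI := Padic.isNonarchimedeanLocalField_holds 2
  intro n g
  have ht : (2 : LTCoeff ℚ_[2]) = LTCoeff.of ℚ_[2] ((2 : ℕ) : 𝒪[ℚ_[2]]) * 1 := by
    rw [mul_one, map_natCast, Nat.cast_ofNat]
  have h := Literature.NumberTheory.GaloisRepresentations.colemanTrace_eq_zero_iff_two
    (Padic.isUniformizer_natCast 2) n (Padic.residueFieldCard_eq 2) ht g
  simpa only [map_one, one_mul] using h

end PadicK2

end Literature.NumberTheory.GaloisRepresentations
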